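import Mathlib.Data.Real.Basic
import Mathlib.Tactic.Linarith
import Mathlib.Tactic.Ring
import Mathlib.Tactic.Positivity
import HarnessLib

/-!
# B′-forest, arithmetic core: the chord of `E₃` along a root pair at a separating vertex

Support file for the Sahi programme (`--supports stmt-CriticalPhenomena-4575`, prover prim-sahi-p2 gen 19).  No definitions, no named
facts, no sorries; pure real arithmetic (standard axioms).  Memo `prim-sahi-p2/PROOF-E3.md` (28s)–(28u), (29d), (29n); lead g120's FC §8 (root pairs
at a separating vertex, 'B′-forest').

**Setting.**  Root `s`, root pair `e = s(s,x)` of weight `p` at an unmarked vertex `x` whose removal splits the environment forest into a side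
`L ∋ a` and a side `R ∋ b, c` (no positive pairs between `L` and `R`).  With `e` deleted the two blocks `L ∪ {s,x}` and `R ∪ {s,x}` are independent
and meet in `{s, x}`; write (block `L`, port `x`, target `a`) `m_a = P(s↔a)`, `D_a = P(x↔a ∧ s↮x)`, `H_a = P(s↔a ∧ s↮x)`, `A_L = P(s↮x)`, and (block `R`,
port `x`, targets `b, c`) `m_b, m_c, m_bc = P(s↔b ∧ s↔c)`, `D_b, D_c, D_bc`, `Ξ_b = P(x↔b ∧ s↮x ∧ s↔c)`, `Ξ_c`, `H_b, H_c, H_bc = P(s↔b ∧ s↔c ∧ s↮x)`,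
`A_R`.  The seven moments of the root-connection events `A = {s↔a}, B, C` are then (2-separator dictionary, `A = A_L ∨ (S_R ∧ F_a)`,
`B = B_R ∨ (S_L ∧ F_b)`, …; exact check gen19 `bprime2.py`, 50/50 apex-forests, all seven moments at four values of `p`):
under `w[e↦0]`  `P(A) = m_a + D_a(1−A_R)`, `P(B) = m_b + D_b(1−A_L)`, `P(AB) = H_a m_b + D_a(m_b − H_b) + (m_a − H_a)(m_b + D_b)`,
`P(BC) = A_L m_bc + (1−A_L)(m_bc + S)`, `P(ABC) = H_a m_bc + D_a(m_bc − H_bc) + (m_a − H_a)(m_bc + S)` (`S = Ξ_b + Ξ_c + D_bc`); under `w[e↦1]`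
(`s ≡ x`) `P(A) = m_a + D_a`, `P(B) = m_b + D_b`, `P(AB) = P(A)P(B)`, `P(BC) = m_bc + S`, `P(ABC) = P(A)P(BC)`; under `w` each moment is the
`p`-mixture.  **Identity** (`rootPairChord_poly`, by `ring`): with `V₁ = A_L·(D_a·Ψ_R + D_bD_c·Br_a)` — `Ψ_R` the two-target functional of
`IncStar.psi_nonneg` on the `R`-block, `Br_a = D_a + 2H_a − A_L(m_a + D_a)` the branch-lemma slack of `IncStar.branchLemma` on the `L`-block — and
`V₀ = V₁ + 3Δ_AΔ_BΔ_C` (`Δ_A = D_aA_R`, `Δ_B = D_bA_L`, `Δ_C = D_cA_L`; `V_t = −f″(t)/2` for the cubic `f(p) = E₃`):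
`E₃(w) − [(1−p)E₃(w[e↦0]) + pE₃(w[e↦1])] = p(1−p)/3 · [(2−p)V₀ + (1+p)V₁]`.
Hence (`rootPairChord_nonneg_real`) the chord inequality — indeed concavity of `p ↦ E₃` on `[0,1]` — along every such root pair of an
apex-forest follows from `Ψ_R ≥ 0` ((I2′)-tree) and `Br_a ≥ 0` (branch lemma), both proved in the tree ('B′-forest ⟸ (I2′)-tree + (L2)-tree +
switching lemma' of the lead, with `(L2) + switching = Br_a` in root-connection form).  The event-level file (the 2-separator dictionary) is left
to the successor; this file is its `ring`/`nlinarith` core.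
-/

namespace Summit.CriticalPhenomena.PercolationContinuityZ3.Theorems

namespace IncStar

/-- **The root-pair chord identity at a separating vertex** (block-moment form; see the file header). [this work] -/
theorem rootPairChord_poly (p ma Da Ha AL mb mc mbc Db Dc Dbc Xb Xc Hb Hc Hbc AR : ℝ) :
    (2 * ((1 - p) * (Ha * mbc + Da * (mbc - Hbc) + (ma - Ha) * (mbc + (Xb + Xc + Dbc))) + p * ((ma + Da) * (mbc + (Xb + Xc + Dbc))))
        + ((1 - p) * (ma + Da * (1 - AR)) + p * (ma + Da)) * ((1 - p) * (mb + Db * (1 - AL)) + p * (mb + Db))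
          * ((1 - p) * (mc + Dc * (1 - AL)) + p * (mc + Dc))
        - (((1 - p) * (ma + Da * (1 - AR)) + p * (ma + Da)) * ((1 - p) * (AL * mbc + (1 - AL) * (mbc + (Xb + Xc + Dbc))) + p * (mbc + (Xb + Xc + Dbc)))
          + ((1 - p) * (mb + Db * (1 - AL)) + p * (mb + Db)) * ((1 - p) * (Ha * mc + Da * (mc - Hc) + (ma - Ha) * (mc + Dc)) + p * ((ma + Da) * (mc + Dc)))
          + ((1 - p) * (mc + Dc * (1 - AL)) + p * (mc + Dc)) * ((1 - p) * (Ha * mb + Da * (mb - Hb) + (ma - Ha) * (mb + Db)) + p * ((ma + Da) * (mb + Db)))))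
      - ((1 - p) * (2 * (Ha * mbc + Da * (mbc - Hbc) + (ma - Ha) * (mbc + (Xb + Xc + Dbc)))
            + (ma + Da * (1 - AR)) * (mb + Db * (1 - AL)) * (mc + Dc * (1 - AL))
            - ((ma + Da * (1 - AR)) * (AL * mbc + (1 - AL) * (mbc + (Xb + Xc + Dbc)))
              + (mb + Db * (1 - AL)) * (Ha * mc + Da * (mc - Hc) + (ma - Ha) * (mc + Dc))
              + (mc + Dc * (1 - AL)) * (Ha * mb + Da * (mb - Hb) + (ma - Ha) * (mb + Db))))
        + p * (2 * ((ma + Da) * (mbc + (Xb + Xc + Dbc))) + (ma + Da) * (mb + Db) * (mc + Dc)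
            - ((ma + Da) * (mbc + (Xb + Xc + Dbc)) + (mb + Db) * ((ma + Da) * (mc + Dc)) + (mc + Dc) * ((ma + Da) * (mb + Db)))))
    = p * (1 - p) / 3 * ((2 - p) * (AL * (Da * (AR * (Xb + Xc + Dbc) - Db * Dc + Db * (Dc + Hc - AR * (mc + Dc)) + Dc * (Db + Hb - AR * (mb + Db)))
            + Db * Dc * (Da + 2 * Ha - AL * (ma + Da))) + 3 * ((Da * AR) * (Db * AL) * (Dc * AL)))
        + (1 + p) * (AL * (Da * (AR * (Xb + Xc + Dbc) - Db * Dc + Db * (Dc + Hc - AR * (mc + Dc)) + Dc * (Db + Hb - AR * (mb + Db)))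
            + Db * Dc * (Da + 2 * Ha - AL * (ma + Da))))) := by
  ring

/-- **B′-forest, arithmetic form.**  The chord of `E₃` along the root pair is nonnegative once `Ψ_R ≥ 0` and `Br_a ≥ 0`. [this work] -/
theorem rootPairChord_nonneg_real (p ma Da Ha AL mb mc mbc Db Dc Dbc Xb Xc Hb Hc Hbc AR : ℝ) (hp0 : 0 ≤ p) (hp1 : p ≤ 1)
    (hAL : 0 ≤ AL) (hAR : 0 ≤ AR) (hDa : 0 ≤ Da) (hDb : 0 ≤ Db) (hDc : 0 ≤ Dc)
    (hPsi : 0 ≤ AR * (Xb + Xc + Dbc) - Db * Dc + Db * (Dc + Hc - AR * (mc + Dc)) + Dc * (Db + Hb - AR * (mb + Db)))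
    (hBr : AL * (ma + Da) ≤ Da + 2 * Ha) :
    (1 - p) * (2 * (Ha * mbc + Da * (mbc - Hbc) + (ma - Ha) * (mbc + (Xb + Xc + Dbc)))
            + (ma + Da * (1 - AR)) * (mb + Db * (1 - AL)) * (mc + Dc * (1 - AL))
            - ((ma + Da * (1 - AR)) * (AL * mbc + (1 - AL) * (mbc + (Xb + Xc + Dbc)))
              + (mb + Db * (1 - AL)) * (Ha * mc + Da * (mc - Hc) + (ma - Ha) * (mc + Dc))
              + (mc + Dc * (1 - AL)) * (Ha * mb + Da * (mb - Hb) + (ma - Ha) * (mb + Db))))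
        + p * (2 * ((ma + Da) * (mbc + (Xb + Xc + Dbc))) + (ma + Da) * (mb + Db) * (mc + Dc)
            - ((ma + Da) * (mbc + (Xb + Xc + Dbc)) + (mb + Db) * ((ma + Da) * (mc + Dc)) + (mc + Dc) * ((ma + Da) * (mb + Db))))
    ≤ 2 * ((1 - p) * (Ha * mbc + Da * (mbc - Hbc) + (ma - Ha) * (mbc + (Xb + Xc + Dbc))) + p * ((ma + Da) * (mbc + (Xb + Xc + Dbc))))
        + ((1 - p) * (ma + Da * (1 - AR)) + p * (ma + Da)) * ((1 - p) * (mb + Db * (1 - AL)) + p * (mb + Db))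
          * ((1 - p) * (mc + Dc * (1 - AL)) + p * (mc + Dc))
        - (((1 - p) * (ma + Da * (1 - AR)) + p * (ma + Da)) * ((1 - p) * (AL * mbc + (1 - AL) * (mbc + (Xb + Xc + Dbc))) + p * (mbc + (Xb + Xc + Dbc)))
          + ((1 - p) * (mb + Db * (1 - AL)) + p * (mb + Db)) * ((1 - p) * (Ha * mc + Da * (mc - Hc) + (ma - Ha) * (mc + Dc)) + p * ((ma + Da) * (mc + Dc)))
          + ((1 - p) * (mc + Dc * (1 - AL)) + p * (mc + Dc)) * ((1 - p) * (Ha * mb + Da * (mb - Hb) + (ma - Ha) * (mb + Db)) + p * ((ma + Da) * (mb + Db)))) := by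
  have key := rootPairChord_poly p ma Da Ha AL mb mc mbc Db Dc Dbc Xb Xc Hb Hc Hbc AR
  have hV1 : 0 ≤ AL * (Da * (AR * (Xb + Xc + Dbc) - Db * Dc + Db * (Dc + Hc - AR * (mc + Dc)) + Dc * (Db + Hb - AR * (mb + Db)))
      + Db * Dc * (Da + 2 * Ha - AL * (ma + Da))) :=
    mul_nonneg hAL (add_nonneg (mul_nonneg hDa hPsi) (mul_nonneg (mul_nonneg hDb hDc) (by linarith)))
  have hD3 : 0 ≤ 3 * ((Da * AR) * (Db * AL) * (Dc * AL)) :=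
    mul_nonneg (by norm_num) (mul_nonneg (mul_nonneg (mul_nonneg hDa hAR) (mul_nonneg hDb hAL)) (mul_nonneg hDc hAL))
  have h2 : 0 ≤ (2 - p) * (AL * (Da * (AR * (Xb + Xc + Dbc) - Db * Dc + Db * (Dc + Hc - AR * (mc + Dc)) + Dc * (Db + Hb - AR * (mb + Db)))
      + Db * Dc * (Da + 2 * Ha - AL * (ma + Da))) + 3 * ((Da * AR) * (Db * AL) * (Dc * AL))) :=
    mul_nonneg (by linarith) (add_nonneg hV1 hD3)
  have h3 : 0 ≤ (1 + p) * (AL * (Da * (AR * (Xb + Xc + Dbc) - Db * Dc + Db * (Dc + Hc - AR * (mc + Dc)) + Dc * (Db + Hb - AR * (mb + Db)))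
      + Db * Dc * (Da + 2 * Ha - AL * (ma + Da)))) := mul_nonneg (by linarith) hV1
  have h4 : 0 ≤ p * (1 - p) / 3 := div_nonneg (mul_nonneg hp0 (by linarith)) (by norm_num)
  nlinarith [mul_nonneg h4 (add_nonneg h2 h3), key]

end IncStar

end Summit.CriticalPhenomena.PercolationContinuityZ3.Theorems
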